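import Summits.KontsevichZagierPeriods.Zeta5Search.WedgeDictionaryLevelDescentRegion
import Summits.KontsevichZagierPeriods.Zeta5Search.WedgeDictionaryLevelDescentZero
import HarnessLib

/-!
# Level descent (LD@N) — S5: the induction. `levelDescentW` and `levelDescentV` from the face value of `U` — PROVED

HONEST FRAMING: systematic search; no irrationality claim unless certified.

gen-1 g7 (planner-pub-zeta5-gen-1-g7-0); design memo `HOME/pub-zeta5-gen-1/D2-LD-PROOF-g7.md` §5, §5b, §9.
Strong induction on `φ(b) = N − max pair sum of the triple` over the region `RW` (file `…LevelDescentRegion`):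
sort the triple by the `{1,2,7}`-transport (`sorted_reduction`, `ldTransport_holds`) so that `b₇ ≤ b₂ ≤ b₁`; on a face (`b₁ + b₂ = N`) use the
base case `ldFaceBaseW/V_holds`; otherwise `d ≥ 1`, `Π₂(b+e₂) ≠ 0`, and the claim at `b` follows from the claims at `b + e₂` and `b + e₂ − e₇`
(`ldStep27_holds` + `crossContiguity_holds`, three-term branch, `b₇ ≥ 1`) or from the claim at `b + e₂` alone (`ldRowStep2_holds` + `casUW_twoTerm`,
two-term branch, `b₇ = 0`, `ζ(3)`-row only — on the constant row `σ ≥ N` excludes it), both hypotheses having `φ` one less and lying in the region.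

Main results (sorry-free):
* `ldInductionW : coeffU_faceExt_stmt → ∀ n b, RW b → 1 ≤ N → φ b ≤ n → casUW b = ldSum W b`, `ldInductionV` (with `σ ≥ N`);
* `ldBox_of_faceExt_holds : coeffU_faceExt_stmt → ldBoxW ∧ ldBoxV` (level `N = 0` from `ldZero_holds`, file `…LevelDescentZero`);
* **`levelDescentWV_of_faceExt_holds : coeffU_faceExt_stmt → levelDescentW ∧ levelDescentV`** — g6's (LD@N) conjectures (T1,
  `…WedgeDictionaryLevelDescent`, text frozen) for the `ζ(3)`-row and the constant row follow from ONE series-side residual: the value of `U`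
  on the hyperplane `b₁ + b₂ = N` (`coeffU_faceExt_stmt`, file `…LevelDescentWeights`; INTERNALLY MINTED, checked exactly on all 55 517 such
  shapes with `N ≤ 6`, 0 failures; P1's `coeffU_face_closed` is its case `b₁ = b₂`).
What this is NOT: a proof of `coeffU_faceExt_stmt`; `levelDescentVFull`; anything about irrationality.
-/

open Finset

namespace Summit.KontsevichZagierPeriods.Zeta5Search.WedgeDictionary

open Summit.KontsevichZagierPeriods.Zeta5Search.DualSeries

/-! ## Measure, box shapes, sorting -/

/-- The measure `φ(b) = N − max(b₁+b₂, b₁+b₇, b₂+b₇)` (≥ 0 on `RW`; `= 0` exactly on a face). -/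
def phi (b : ℕ → ℤ) : ℤ := b 0 - max (b 1 + b 2) (max (b 1 + b 7) (b 2 + b 7))

/-- The measure is swap-invariant. -/
theorem phi_swap (b : ℕ → ℤ) {j k : ℕ} (hj : j ∈ ({1, 2, 7} : Finset ℕ)) (hk : k ∈ ({1, 2, 7} : Finset ℕ)) :
    phi (fun i => b (Equiv.swap j k i)) = phi b := by
  unfold phi
  simp only [swap_b0 b hj hk]
  simp only [mem_insert, mem_singleton] at hj hk
  rcases hj with rfl | rfl | rfl <;> rcases hk with rfl | rfl | rfl <;>
    simp [Equiv.swap_apply_def] <;> omega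

/-- Every `LDBoxHyp` shape lies in the region. -/
theorem RW_of_LDBoxHyp (b : ℕ → ℤ) (h : LDBoxHyp b) : RW b := by
  obtain ⟨hb, hB, hd, hcl⟩ := h
  have hs := (inBox_iff b).1 hb
  rw [rw_iff]
  rw [Icc_one_seven] at hB
  simp only [mem_insert, mem_singleton, forall_eq_or_imp, forall_eq] at hB
  unfold sigmaT
  omega

/-- A swap-stable predicate that holds on the sorted shapes `b₇ ≤ b₂ ≤ b₁` holds everywhere. -/
theorem sorted_reduction (Q : (ℕ → ℤ) → Prop)
    (hQ : ∀ (b : ℕ → ℤ) (j k : ℕ), j ∈ ({1, 2, 7} : Finset ℕ) → k ∈ ({1, 2, 7} : Finset ℕ) →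
      Q (fun i => b (Equiv.swap j k i)) → Q b)
    (hs : ∀ b : ℕ → ℤ, b 7 ≤ b 2 → b 2 ≤ b 1 → Q b) (b : ℕ → ℤ) : Q b := by
  have m1 : (1 : ℕ) ∈ ({1, 2, 7} : Finset ℕ) := by simp
  have m2 : (2 : ℕ) ∈ ({1, 2, 7} : Finset ℕ) := by simp
  have m7 : (7 : ℕ) ∈ ({1, 2, 7} : Finset ℕ) := by simp
  rcases le_total (b 2) (b 1) with h21 | h12 <;> rcases le_total (b 7) (b 2) with h72 | h27 <;>
    rcases le_total (b 7) (b 1) with h71 | h17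
  · exact hs b h72 h21
  · exact hs b h72 h21
  · exact hQ b 2 7 m2 m7 (hs _ (by simpa [Equiv.swap_apply_def] using h27) (by simpa [Equiv.swap_apply_def] using h71))
  · refine hQ b 1 7 m1 m7 (hQ _ 2 7 m2 m7 (hs _ ?_ ?_))
    · simpa [Equiv.swap_apply_def] using h21
    · simpa [Equiv.swap_apply_def] using h17
  · exact hQ b 1 2 m1 m2 (hs _ (by simpa [Equiv.swap_apply_def] using h71) (by simpa [Equiv.swap_apply_def] using h12))
  · refine hQ b 1 2 m1 m2 (hQ _ 2 7 m2 m7 (hs _ ?_ ?_))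
    · simpa [Equiv.swap_apply_def] using h17
    · simpa [Equiv.swap_apply_def] using h72
  · exact hs b (by omega) (by omega)
  · exact hQ b 1 7 m1 m7 (hs _ (by simpa [Equiv.swap_apply_def] using h12) (by simpa [Equiv.swap_apply_def] using h27))

/-- Transport of the induction predicate for the `ζ(3)`-row. -/
theorem QW_transport (n : ℤ) (b : ℕ → ℤ) (j k : ℕ) (hj : j ∈ ({1, 2, 7} : Finset ℕ)) (hk : k ∈ ({1, 2, 7} : Finset ℕ))
    (hQ : RW (fun i => b (Equiv.swap j k i)) → 1 ≤ (fun i => b (Equiv.swap j k i)) 0 →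
      phi (fun i => b (Equiv.swap j k i)) ≤ n → PW (fun i => b (Equiv.swap j k i))) :
    RW b → 1 ≤ b 0 → phi b ≤ n → PW b := fun hR hN hphi =>
  PW_of_swap b hj hk hR (hQ (RW_swap b hj hk hR) (by simp only [swap_b0 b hj hk]; exact hN)
    (by rw [phi_swap b hj hk]; exact hphi))

/-- Transport of the induction predicate for the constant row. -/
theorem QV_transport (n : ℤ) (b : ℕ → ℤ) (j k : ℕ) (hj : j ∈ ({1, 2, 7} : Finset ℕ)) (hk : k ∈ ({1, 2, 7} : Finset ℕ))
    (hQ : RW (fun i => b (Equiv.swap j k i)) → (fun i => b (Equiv.swap j k i)) 0 ≤ sigmaT (fun i => b (Equiv.swap j k i)) →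
      1 ≤ (fun i => b (Equiv.swap j k i)) 0 → phi (fun i => b (Equiv.swap j k i)) ≤ n → PV (fun i => b (Equiv.swap j k i))) :
    RW b → b 0 ≤ sigmaT b → 1 ≤ b 0 → phi b ≤ n → PV b := fun hR hσ hN hphi =>
  PV_of_swap b hj hk hR (hQ (RW_swap b hj hk hR) (by simp only [swap_b0 b hj hk, sigmaT_swap b hj hk]; exact hσ)
    (by simp only [swap_b0 b hj hk]; exact hN) (by rw [phi_swap b hj hk]; exact hphi))

/-! ## The step at a sorted shape -/

section step
variable (b : ℕ → ℤ) (hR : RW b) (hN1 : 1 ≤ b 0) (h72 : b 7 ≤ b 2) (h21 : b 2 ≤ b 1) (hlt : b 1 + b 2 + 1 ≤ b 0)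
include hR hN1 h72 h21 hlt

/-- The data of the shape `b⁺ = b + e₂` at a sorted non-face region shape. -/
theorem bplus_facts :
    let bp := Function.update b 2 (b 2 + 1)
    bp 0 = b 0 ∧ bp 1 = b 1 ∧ bp 2 = b 2 + 1 ∧ bp 7 = b 7 ∧ dOf bp = dOf b - 1 ∧ sigmaT bp = sigmaT b + 1 ∧
      lowerSlot bp 2 = b ∧ RW bp ∧ (∀ j ∈ Icc 3 6, 2 * bp j ≤ bp 0) ∧ mixedPi2 bp ≠ 0 ∧ 1 ≤ dOf b := by
  intro bp
  have h := (rw_iff b).1 hR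
  have bpv : ∀ s, bp s = if s = 2 then b 2 + 1 else b s := fun s => by
    simp only [bp, Function.update_apply]
  have bp0 : bp 0 = b 0 := by rw [bpv]; simp
  have bp1 : bp 1 = b 1 := by rw [bpv]; simp
  have bp2 : bp 2 = b 2 + 1 := by rw [bpv]; simp
  have bp3 : bp 3 = b 3 := by rw [bpv]; simp
  have bp4 : bp 4 = b 4 := by rw [bpv]; simp
  have bp5 : bp 5 = b 5 := by rw [bpv]; simp
  have bp6 : bp 6 = b 6 := by rw [bpv]; simp
  have bp7 : bp 7 = b 7 := by rw [bpv]; simp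
  have dbp : dOf bp = dOf b - 1 := by
    simp only [dOf, sum_range_succ, sum_range_zero, Nat.reduceAdd, bpv]; simp; ring
  have sbp : sigmaT bp = sigmaT b + 1 := by unfold sigmaT; rw [bp1, bp2, bp7]; ring
  have hd1 : 1 ≤ dOf b := by unfold sigmaT at h; omega
  have hlow : lowerSlot bp 2 = b := by
    funext s
    rw [lowerSlot2_apply, bpv, bpv]
    by_cases hs : s = 2 <;> simp [hs]
  have hRbp : RW bp := by
    rw [rw_iff, sbp, dbp, bp0, bp1, bp2, bp3, bp4, bp5, bp6, bp7]; unfold sigmaT at h ⊢; omega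
  have hPi2 : mixedPi2 bp ≠ 0 := by
    unfold mixedPi2
    refine prod_ne_zero_iff.2 fun j hj => ?_
    have hj' : bp j = b j ∧ b 2 + b j + 1 ≤ b 0 := by
      simp only [mem_insert, mem_singleton] at hj
      rcases hj with rfl | rfl | rfl | rfl | rfl
      · exact ⟨bp1, by omega⟩
      · exact ⟨bp3, by omega⟩
      · exact ⟨bp4, by omega⟩
      · exact ⟨bp5, by omega⟩
      · exact ⟨bp6, by omega⟩
    rw [bp0, bp2, hj'.1]
    have hz : ((b 0 : ℚ) - ((b 2 + 1 : ℤ) : ℚ) - (b j : ℚ) + 1) = ((b 0 - b 2 - b j : ℤ) : ℚ) := by push_cast; ring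
    rw [hz]
    exact_mod_cast (show (b 0 - b 2 - b j : ℤ) ≠ 0 by omega)
  exact ⟨bp0, bp1, bp2, bp7, dbp, sbp, hlow, hRbp, hRbp.2.2.1, hPi2, hd1⟩

/-- The data of the shape `b⁺ − e₇` (three-term branch, `b₇ ≥ 1`). -/
theorem bminus_facts (h71 : 1 ≤ b 7) :
    let bm := lowerSlot (Function.update b 2 (b 2 + 1)) 7
    bm 0 = b 0 ∧ RW bm ∧ phi bm + 1 = phi b ∧ sigmaT bm = sigmaT b := by
  intro bm
  have h := (rw_iff b).1 hR
  have bmv : ∀ s, bm s = if s = 7 then b 7 - 1 else if s = 2 then b 2 + 1 else b s := fun s => by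
    simp only [bm, lowerSlot, Function.update_apply]
    by_cases h7 : s = 7
    · subst h7; simp
    · simp [h7]
  have bm0 : bm 0 = b 0 := by rw [bmv]; simp
  have bm1 : bm 1 = b 1 := by rw [bmv]; simp
  have bm2 : bm 2 = b 2 + 1 := by rw [bmv]; simp
  have bm3 : bm 3 = b 3 := by rw [bmv]; simp
  have bm4 : bm 4 = b 4 := by rw [bmv]; simp
  have bm5 : bm 5 = b 5 := by rw [bmv]; simp
  have bm6 : bm 6 = b 6 := by rw [bmv]; simp
  have bm7 : bm 7 = b 7 - 1 := by rw [bmv]; simp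
  have dbm : dOf bm = dOf b := by
    simp only [dOf, sum_range_succ, sum_range_zero, Nat.reduceAdd, bmv]; simp; ring
  have sbm : sigmaT bm = sigmaT b := by unfold sigmaT; rw [bm1, bm2, bm7]; ring
  have hRbm : RW bm := by
    rw [rw_iff, sbm, dbm, bm0, bm1, bm2, bm3, bm4, bm5, bm6, bm7]; unfold sigmaT at h ⊢; omega
  have hphi : phi bm + 1 = phi b := by unfold phi; rw [bm0, bm1, bm2, bm7]; omega
  exact ⟨bm0, hRbm, hphi, sbm⟩

end step

/-- **The sorted step, `ζ(3)`-row.** -/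
theorem stepW_sorted (hU : coeffU_faceExt_stmt) {n : ℕ}
    (IH : ∀ b' : ℕ → ℤ, RW b' → 1 ≤ b' 0 → phi b' ≤ n → PW b')
    (b : ℕ → ℤ) (hR : RW b) (hN1 : 1 ≤ b 0) (hphi : phi b ≤ n + 1) (h72 : b 7 ≤ b 2) (h21 : b 2 ≤ b 1) :
    PW b := by
  have hS := slots_of_RW b hR
  have hd : 0 ≤ dOf b := hR.2.2.2.1
  by_cases hface : b 1 + b 2 = b 0
  · exact ldFaceBaseW_holds hU b hN1 hS hd hface
  have hlt : b 1 + b 2 + 1 ≤ b 0 := by have := hR.2.2.2.2.1; omega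
  obtain ⟨bp0, bp1, bp2, bp7, dbp, -, hlow, hRbp, hBbp, hPi2, hd1⟩ := bplus_facts b hR hN1 h72 h21 hlt
  set bp := Function.update b 2 (b 2 + 1) with hbp
  have hSbp := slots_of_RW bp hRbp
  have hdbp : 0 ≤ dOf bp := by rw [dbp]; omega
  have h2bp : 1 ≤ bp 2 := by rw [bp2]; have := (hS 2 (by simp)).1; omega
  have h0bp : 0 ≤ bp 0 := by rw [bp0]; omega
  have hphibp : phi bp ≤ n := by unfold phi at hphi ⊢; rw [bp0, bp1, bp2, bp7]; omega
  have hPbp : PW bp := IH bp hRbp (by rw [bp0]; exact hN1) hphibp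
  by_cases h70 : b 7 = 0
  · -- two-term branch
    have h7bp : bp 7 = 0 := by rw [bp7]; exact h70
    have htt := casUW_twoTerm bp (inBox_of_RW bp hRbp) h7bp hdbp h2bp (hSbp 2 (by simp)).2
    have key := ldRowStep2_holds coeffW casUW bp h0bp hSbp hBbp hdbp h2bp h7bp hPi2 htt hPbp
    unfold PW
    rwa [hlow] at key
  · -- three-term branch
    have h71 : 1 ≤ b 7 := by have := (hS 7 (by simp)).1; omega
    obtain ⟨bm0, hRbm, hphibm, -⟩ := bminus_facts b hR hN1 h72 h21 hlt h71
    have hPbm : PW (lowerSlot bp 7) := IH _ hRbm (by rw [bm0]; exact hN1) (by rw [hbp]; omega)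
    have h7bp : 1 ≤ bp 7 := by rw [bp7]; exact h71
    have hMix : MixedHyp bp :=
      ⟨inBox_of_RW bp hRbp, hdbp, h2bp, h7bp, by rw [bp2, bp7, bp0]; omega, fun j hj => (hSbp j hj).2⟩
    have hX := (crossContiguity_holds bp hMix).1
    have hPi : (bp 2 : ℚ) * mixedPi2 bp ≠ 0 :=
      mul_ne_zero (by exact_mod_cast (show bp 2 ≠ 0 by omega)) hPi2
    have key := ldStep27_holds coeffW casUW bp h0bp hSbp hBbp hdbp h2bp h7bp hPi hX hPbp hPbm
    unfold PW
    rwa [hlow] at key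

/-- **The sorted step, constant row** (no two-term branch: `σ ≥ N` and `b₇ = 0` force a face). -/
theorem stepV_sorted (hU : coeffU_faceExt_stmt) {n : ℕ}
    (IH : ∀ b' : ℕ → ℤ, RW b' → b' 0 ≤ sigmaT b' → 1 ≤ b' 0 → phi b' ≤ n → PV b')
    (b : ℕ → ℤ) (hR : RW b) (hσ : b 0 ≤ sigmaT b) (hN1 : 1 ≤ b 0) (hphi : phi b ≤ n + 1)
    (h72 : b 7 ≤ b 2) (h21 : b 2 ≤ b 1) : PV b := by
  have hS := slots_of_RW b hR
  have hd : 0 ≤ dOf b := hR.2.2.2.1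
  by_cases hface : b 1 + b 2 = b 0
  · exact ldFaceBaseV_holds hU b hN1 hS hd hface
  have hlt : b 1 + b 2 + 1 ≤ b 0 := by have := hR.2.2.2.2.1; omega
  obtain ⟨bp0, bp1, bp2, bp7, dbp, sbp, hlow, hRbp, hBbp, hPi2, hd1⟩ := bplus_facts b hR hN1 h72 h21 hlt
  set bp := Function.update b 2 (b 2 + 1) with hbp
  have hSbp := slots_of_RW bp hRbp
  have hdbp : 0 ≤ dOf bp := by rw [dbp]; omega
  have h2bp : 1 ≤ bp 2 := by rw [bp2]; have := (hS 2 (by simp)).1; omega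
  have h0bp : 0 ≤ bp 0 := by rw [bp0]; omega
  have hphibp : phi bp ≤ n := by unfold phi at hphi ⊢; rw [bp0, bp1, bp2, bp7]; omega
  have hPbp : PV bp := IH bp hRbp (by rw [bp0, sbp]; omega) (by rw [bp0]; exact hN1) hphibp
  have h71 : 1 ≤ b 7 := by unfold sigmaT at hσ; have := (hS 7 (by simp)).1; omega
  obtain ⟨bm0, hRbm, hphibm, sbm⟩ := bminus_facts b hR hN1 h72 h21 hlt h71
  have hPbm : PV (lowerSlot bp 7) := IH _ hRbm (by rw [bm0, sbm]; exact hσ) (by rw [bm0]; exact hN1) (by rw [hbp]; omega)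
  have h7bp : 1 ≤ bp 7 := by rw [bp7]; exact h71
  have hMix : MixedHyp bp :=
    ⟨inBox_of_RW bp hRbp, hdbp, h2bp, h7bp, by rw [bp2, bp7, bp0]; omega, fun j hj => (hSbp j hj).2⟩
  have hX := (crossContiguity_holds bp hMix).2.1
  have hPi : (bp 2 : ℚ) * mixedPi2 bp ≠ 0 :=
    mul_ne_zero (by exact_mod_cast (show bp 2 ≠ 0 by omega)) hPi2
  have key := ldStep27_holds coeffV casUV bp h0bp hSbp hBbp hdbp h2bp h7bp hPi hX hPbp hPbm
  unfold PV
  rwa [hlow] at key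

/-! ## The induction -/

/-- **Induction, `ζ(3)`-row**: on the region with `N ≥ 1`, the face value of `U` implies `casUW b = ldSum W b`. -/
theorem ldInductionW (hU : coeffU_faceExt_stmt) :
    ∀ (n : ℕ) (b : ℕ → ℤ), RW b → 1 ≤ b 0 → phi b ≤ n → PW b := by
  intro n
  induction n with
  | zero =>
    intro b hR hN1 hphi
    refine sorted_reduction (fun b => RW b → 1 ≤ b 0 → phi b ≤ ((0 : ℕ) : ℤ) → PW b)
      (fun b j k hj hk hQ => QW_transport _ b j k hj hk hQ) ?_ b hR hN1 hphi
    intro b h72 h21 hR hN1 hphi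
    have hface : b 1 + b 2 = b 0 := by have := hR.2.2.2.2.1; unfold phi at hphi; push_cast at hphi; omega
    exact ldFaceBaseW_holds hU b hN1 (slots_of_RW b hR) hR.2.2.2.1 hface
  | succ n ih =>
    intro b hR hN1 hphi
    refine sorted_reduction (fun b => RW b → 1 ≤ b 0 → phi b ≤ ((n + 1 : ℕ) : ℤ) → PW b)
      (fun b j k hj hk hQ => QW_transport _ b j k hj hk hQ) ?_ b hR hN1 hphi
    intro b h72 h21 hR hN1 hphi
    push_cast at hphi
    exact stepW_sorted hU ih b hR hN1 hphi h72 h21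

/-- **Induction, constant row**: on the region with `σ ≥ N`, `N ≥ 1`, the face value of `U` implies `casUV b = ldSum V b`. -/
theorem ldInductionV (hU : coeffU_faceExt_stmt) :
    ∀ (n : ℕ) (b : ℕ → ℤ), RW b → b 0 ≤ sigmaT b → 1 ≤ b 0 → phi b ≤ n → PV b := by
  intro n
  induction n with
  | zero =>
    intro b hR hσ hN1 hphi
    refine sorted_reduction (fun b => RW b → b 0 ≤ sigmaT b → 1 ≤ b 0 → phi b ≤ ((0 : ℕ) : ℤ) → PV b)
      (fun b j k hj hk hQ => QV_transport _ b j k hj hk hQ) ?_ b hR hσ hN1 hphi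
    intro b h72 h21 hR hσ hN1 hphi
    have hface : b 1 + b 2 = b 0 := by have := hR.2.2.2.2.1; unfold phi at hphi; push_cast at hphi; omega
    exact ldFaceBaseV_holds hU b hN1 (slots_of_RW b hR) hR.2.2.2.1 hface
  | succ n ih =>
    intro b hR hσ hN1 hphi
    refine sorted_reduction (fun b => RW b → b 0 ≤ sigmaT b → 1 ≤ b 0 → phi b ≤ ((n + 1 : ℕ) : ℤ) → PV b)
      (fun b j k hj hk hQ => QV_transport _ b j k hj hk hQ) ?_ b hR hσ hN1 hphi
    intro b h72 h21 hR hσ hN1 hphi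
    push_cast at hphi
    exact stepV_sorted hU ih b hR hσ hN1 hphi h72 h21

/-! ## Assembly: (LD@N) for the `ζ(3)`-row and the constant row from the face value of `U` -/

/-- STATEMENT (PROVED below as `ldBox_of_faceExt_holds`): the m-indexed identities `ldBoxW`, `ldBoxV` follow from the face value of `U`. -/
def ldBox_of_faceExt_stmt : Prop := coeffU_faceExt_stmt → ldBoxW ∧ ldBoxV

/-- `ldBox_of_faceExt_stmt` holds: level `N = 0` is `ldZero_holds`; for `N ≥ 1` run the induction up to `φ(b)`. -/
theorem ldBox_of_faceExt_holds : ldBox_of_faceExt_stmt := by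
  intro hU
  refine ⟨fun b hb => ?_, fun b hb hcl => ?_⟩
  · by_cases hN : b 0 = 0
    · exact (ldZero_holds hU b hb hN).1
    · exact ldInductionW hU (phi b).toNat b (RW_of_LDBoxHyp b hb) (by have := hb.1.1; omega) (Int.self_le_toNat _)
  · by_cases hN : b 0 = 0
    · exact (ldZero_holds hU b hb hN).2
    · exact ldInductionV hU (phi b).toNat b (RW_of_LDBoxHyp b hb) (by unfold sigmaT; omega) (by have := hb.1.1; omega)
        (Int.self_le_toNat _)

/-- STATEMENT (PROVED below as `levelDescentWV_of_faceExt_holds`): g6's level-descent conjectures `levelDescentW` (the `ζ(3)`-row) and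
`levelDescentV` (the constant row) follow from the face value of `U` (`coeffU_faceExt_stmt`). -/
def levelDescentWV_of_faceExt_stmt : Prop := coeffU_faceExt_stmt → levelDescentW ∧ levelDescentV

/-- **(LD@N) for the `ζ(3)`-row and the constant row, modulo the face value of `U` — PROVED.** -/
theorem levelDescentWV_of_faceExt_holds : levelDescentWV_of_faceExt_stmt := fun hU =>
  ⟨levelDescentW_reduction_holds (ldBox_of_faceExt_holds hU).1, levelDescentV_reduction_holds (ldBox_of_faceExt_holds hU).2⟩

end Summit.KontsevichZagierPeriods.Zeta5Search.WedgeDictionary
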